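import Summits.AtomisticToContinuum.Crystallization.Theorems.ChargedEnergyGapDominoLedgerK
import HarnessLib

/-!
# SqrtTangent (lens-3 g90, NODE 102) — first-order envelope of a square-root depth with an ALGEBRAIC second-order remainder

The COST side of the census (CELLCERT v0.2 §4 «env» rows for the six vertex DEPTHS of the designated hole) linearises each depth map
`z ↦ d_v(z) = √(Q_v(z))` (`Q_v` a quadratic polynomial in the cell coordinates `z = (t, α, k, e₁…e₄, u…)`) around the cell centre `z₀`:
along `δ = z − z₀`, `Q_v(z₀ + δ) = c + b + a` with `c = Q_v(z₀) = d₀²`, `b = ∇Q_v(z₀)·δ` (LINEAR in `δ`), `a = δᵀAδ` (quadratic, `|a| ≤ a_max` on the cell).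
This file certifies the remainder with NO calculus (no Taylor theorem, no derivatives): for `0 < m`, `m² ≤ c`, `m² ≤ a + b + c`,

  ★ `|√(a+b+c) − √c − b/(2√c)| ≤ |a|/(2m) + |b|·(|a|+|b|)/(8m³)`                                   (`sqrt_tangent_bound`)

from the identity `√(a+b+c) − √c − b/(2√c) = a/(r₁+r₀) − b(a+b)/(2r₀(r₁+r₀)²)` (`r₀ = √c`, `r₁ = √(a+b+c)`, `r₁² − r₀² = a + b`), and the
census-facing cell form with a RATIONAL centre depth `d₀ ≈ √c` and slope factor `g₀ ≈ 1/(2√c)`: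

  ★ `sqrt_cell_env : |√c − d₀| ≤ ε → |1/(2√c) − g₀| ≤ η → |a| ≤ amax → |b| ≤ bmax → ε + η·bmax + amax/(2m) + bmax·(amax+bmax)/(8m³) ≤ E →
        d₀ + g₀·b − E ≤ √(a+b+c) ∧ √(a+b+c) ≤ d₀ + g₀·b + E`

(every hypothesis a closed rational inequality once `a, b` are instantiated by the cell's polynomial data; `b ↦ g₀·b` keeps the row LINEAR in `δ`).
Elementary; stated here because Mathlib has the calculus route (`taylor_mean_remainder_lagrange`) but not this division-free form.
-/

noncomputable section
open scoped Classical

namespace Summit.AtomisticToContinuum.Crystallization.Theorems.ChargedEnergyGapChartDial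

/-- `m ≤ √x` from `m² ≤ x` (`0 < m`). -/
theorem le_sqrt_of_sq_le {m x : ℝ} (hm : 0 < m) (hx : m ^ 2 ≤ x) : m ≤ Real.sqrt x := by
  calc m = Real.sqrt (m ^ 2) := (Real.sqrt_sq hm.le).symm
    _ ≤ Real.sqrt x := Real.sqrt_le_sqrt hx

/-- ★ The algebraic tangent remainder of the square root: `|√(a+b+c) − √c − b/(2√c)| ≤ |a|/(2m) + |b|(|a|+|b|)/(8m³)`. -/
theorem sqrt_tangent_bound {a b c m : ℝ} (hm : 0 < m) (hc : m ^ 2 ≤ c) (h1 : m ^ 2 ≤ a + b + c) :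
    |Real.sqrt (a + b + c) - Real.sqrt c - b / (2 * Real.sqrt c)| ≤ |a| / (2 * m) + |b| * (|a| + |b|) / (8 * m ^ 3) := by
  have hm2 : 0 < m ^ 2 := by positivity
  set r0 := Real.sqrt c with hr0
  set r1 := Real.sqrt (a + b + c) with hr1
  have hr0m : m ≤ r0 := le_sqrt_of_sq_le hm hc
  have hr1m : m ≤ r1 := le_sqrt_of_sq_le hm h1
  have hr0 : 0 < r0 := lt_of_lt_of_le hm hr0m
  have hr1 : 0 < r1 := lt_of_lt_of_le hm hr1m
  have hsq0 : r0 ^ 2 = c := Real.sq_sqrt (le_trans hm2.le hc)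
  have hsq1 : r1 ^ 2 = a + b + c := Real.sq_sqrt (le_trans hm2.le h1)
  have hs : 0 < r1 + r0 := by linarith
  -- the identity (division-free core: `key`, then two pure field identities)
  have key : r1 ^ 2 - r0 ^ 2 = a + b := by rw [hsq0, hsq1]; ring
  have hD : 0 < 2 * r0 * (r1 + r0) ^ 2 := by positivity
  have hid1 : (r1 - r0 - b / (2 * r0)) * (2 * r0 * (r1 + r0) ^ 2) = (r1 - r0) * (2 * r0 * (r1 + r0) ^ 2) - b * (r1 + r0) ^ 2 := by
    field_simp
  have hid2 : (r1 - r0) * (2 * r0 * (r1 + r0) ^ 2) - b * (r1 + r0) ^ 2 = 2 * r0 * a * (r1 + r0) - b * (a + b) := by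
    linear_combination (2 * r0 * (r1 + r0) - b) * key
  have hid3 : r1 - r0 - b / (2 * r0) = (2 * r0 * a * (r1 + r0) - b * (a + b)) / (2 * r0 * (r1 + r0) ^ 2) := by
    rw [eq_div_iff hD.ne', hid1, hid2]
  have hid4 : (2 * r0 * a * (r1 + r0) - b * (a + b)) / (2 * r0 * (r1 + r0) ^ 2) = a / (r1 + r0) - b * (a + b) / (2 * r0 * (r1 + r0) ^ 2) := by
    field_simp
  rw [hid3, hid4]
  -- bound the two fractions
  have hA : |a / (r1 + r0)| ≤ |a| / (2 * m) := by
    rw [abs_div, abs_of_pos hs]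
    exact div_le_div_of_nonneg_left (abs_nonneg a) (by positivity) (by linarith)
  have hB : |b * (a + b) / (2 * r0 * (r1 + r0) ^ 2)| ≤ |b| * (|a| + |b|) / (8 * m ^ 3) := by
    rw [abs_div, abs_of_pos hD, abs_mul]
    have hnum : |b| * |a + b| ≤ |b| * (|a| + |b|) := mul_le_mul_of_nonneg_left (abs_add_le a b) (abs_nonneg b)
    have hden : 8 * m ^ 3 ≤ 2 * r0 * (r1 + r0) ^ 2 := by
      have h2m : 2 * m ≤ r1 + r0 := by linarith
      have h4 : (2 * m) ^ 2 ≤ (r1 + r0) ^ 2 := pow_le_pow_left₀ (by linarith) h2m 2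
      nlinarith [mul_le_mul hr0m h4 (by positivity) hr0.le]
    exact div_le_div₀ (by positivity) hnum (by positivity) hden
  calc |a / (r1 + r0) - b * (a + b) / (2 * r0 * (r1 + r0) ^ 2)|
      ≤ |a / (r1 + r0)| + |b * (a + b) / (2 * r0 * (r1 + r0) ^ 2)| := by
        simpa [sub_eq_add_neg, abs_neg] using abs_add_le (a / (r1 + r0)) (-(b * (a + b) / (2 * r0 * (r1 + r0) ^ 2)))
    _ ≤ |a| / (2 * m) + |b| * (|a| + |b|) / (8 * m ^ 3) := add_le_add hA hB

/-- Monotonicity of the remainder in `|a| ≤ amax`, `|b| ≤ bmax`. -/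
theorem tangent_remainder_mono {a b m amax bmax : ℝ} (hm : 0 < m) (ha : |a| ≤ amax) (hb : |b| ≤ bmax) :
    |a| / (2 * m) + |b| * (|a| + |b|) / (8 * m ^ 3) ≤ amax / (2 * m) + bmax * (amax + bmax) / (8 * m ^ 3) := by
  have h1 : |a| / (2 * m) ≤ amax / (2 * m) := div_le_div_of_nonneg_right ha (by positivity)
  have h2 : |b| * (|a| + |b|) ≤ bmax * (amax + bmax) :=
    mul_le_mul hb (add_le_add ha hb) (by positivity) (le_trans (abs_nonneg b) hb)
  have h3 : |b| * (|a| + |b|) / (8 * m ^ 3) ≤ bmax * (amax + bmax) / (8 * m ^ 3) := div_le_div_of_nonneg_right h2 (by positivity)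
  linarith

/-- ★ THE CENSUS ROW: a two-sided AFFINE envelope `d₀ + g₀·b ± E` of `√(a+b+c)` with rational centre data `(d₀, g₀)` and one rational slack `E`. -/
theorem sqrt_cell_env {a b c m d₀ g₀ ε η amax bmax E : ℝ} (hm : 0 < m) (hc : m ^ 2 ≤ c) (h1 : m ^ 2 ≤ a + b + c)
    (hd : |Real.sqrt c - d₀| ≤ ε) (hg : |1 / (2 * Real.sqrt c) - g₀| ≤ η) (ha : |a| ≤ amax) (hb : |b| ≤ bmax)
    (hE : ε + η * bmax + (amax / (2 * m) + bmax * (amax + bmax) / (8 * m ^ 3)) ≤ E) :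
    d₀ + g₀ * b - E ≤ Real.sqrt (a + b + c) ∧ Real.sqrt (a + b + c) ≤ d₀ + g₀ * b + E := by
  have hT := le_trans (sqrt_tangent_bound hm hc h1) (tangent_remainder_mono hm ha hb)
  -- |b/(2√c) − g₀ b| ≤ η·bmax
  have hslope : |b / (2 * Real.sqrt c) - g₀ * b| ≤ η * bmax := by
    have : b / (2 * Real.sqrt c) - g₀ * b = (1 / (2 * Real.sqrt c) - g₀) * b := by ring
    rw [this, abs_mul]
    exact mul_le_mul hg hb (abs_nonneg b) (le_trans (abs_nonneg _) hg)
  rw [abs_le] at hT hd hslope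
  constructor <;> linarith [hT.1, hT.2, hd.1, hd.2, hslope.1, hslope.2]

/-- Brackets for the centre data from rational squares: `dlo ≤ √c ≤ dhi` from `dlo² ≤ c ≤ dhi²` (`0 ≤ dlo`, `0 ≤ dhi`). -/
theorem sqrt_mem_brackets {c dlo dhi : ℝ} (hlo : 0 ≤ dlo) (hhi : 0 ≤ dhi) (h₀ : dlo ^ 2 ≤ c) (h₁ : c ≤ dhi ^ 2) :
    dlo ≤ Real.sqrt c ∧ Real.sqrt c ≤ dhi :=
  ⟨by simpa [Real.sqrt_sq hlo] using Real.sqrt_le_sqrt h₀, by simpa [Real.sqrt_sq hhi] using Real.sqrt_le_sqrt h₁⟩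

/-- … hence `|√c − d₀| ≤ ε` and `|1/(2√c) − g₀| ≤ η` from the brackets (closed rational side conditions). -/
theorem centre_data_of_brackets {c dlo dhi d₀ g₀ ε η : ℝ} (hlo : 0 < dlo) (hhi : 0 ≤ dhi) (h₀ : dlo ^ 2 ≤ c) (h₁ : c ≤ dhi ^ 2)
    (hε₀ : d₀ - ε ≤ dlo) (hε₁ : dhi ≤ d₀ + ε) (hη₀ : g₀ - η ≤ 1 / (2 * dhi)) (hη₁ : 1 / (2 * dlo) ≤ g₀ + η) :
    |Real.sqrt c - d₀| ≤ ε ∧ |1 / (2 * Real.sqrt c) - g₀| ≤ η := by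
  obtain ⟨hl, hh⟩ := sqrt_mem_brackets hlo.le hhi h₀ h₁
  have hpos : 0 < Real.sqrt c := lt_of_lt_of_le hlo hl
  have hdhi : 0 < dhi := lt_of_lt_of_le hpos hh
  refine ⟨abs_le.2 ⟨by linarith, by linarith⟩, abs_le.2 ⟨?_, ?_⟩⟩
  · have : 1 / (2 * dhi) ≤ 1 / (2 * Real.sqrt c) := by
      apply div_le_div_of_nonneg_left (by norm_num) (by positivity) (by linarith)
    linarith
  · have : 1 / (2 * Real.sqrt c) ≤ 1 / (2 * dlo) := by
      apply div_le_div_of_nonneg_left (by norm_num) (by positivity) (by linarith)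
    linarith

end Summit.AtomisticToContinuum.Crystallization.Theorems.ChargedEnergyGapChartDial

end
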